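/-
Copyright: the b2b-balaban cell (near-miss cell 7), T⁴-continuum fan-out; row NE7b ROUND-2 swarm, seat
t4-ne7b-formalise-leaf-03 (row S12 of `t4/b2b-balaban-t4-ne7b-p1/LEAVES-NE7b.md`).  Released under the licence of the
surrounding project.
-/
import Summits.QuantumFields.BalabanUV.T4Continuum.Support.ZoneTorus
import Literature.MathematicalPhysics.QuantumFieldTheory.Balaban1983to89.T4CanonicalMenus
import Literature.MathematicalPhysics.QuantumFieldTheory.Balaban1983to89.T4RenewalChains

/-!
# History tables: the MODEL CONSTANTS of the NE7b count exit, fixed once and their binders discharged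

Summits-side support leaf of the T⁴-continuum cell (rung (B)+1 on a FINITE torus only; NOT infinite volume, NOT the
mass gap, NOT the Clay statement; NOT a proof of the spine estimate NE7b).  Row NE7b, route «COUNT», ROUND-2 swarm
claim table `t4/b2b-balaban-t4-ne7b-p1/LEAVES-NE7b.md`, row S12 (assembly) — its §1, split off as a LIGHT module so
that the leaf rows S4–S7∕S10 and the assembly import the SAME tables.  [folklore] finite combinatorics and real
arithmetic over the lineage's OWN carrier (`T4PersistenceDictionary`, `T4RecordPriceSeam`, `T4CanonicalMenus`,
`T4RenewalChains.jhalf`, `Support/ZoneTorus`); nothing is quoted from print, nothing printed is asserted, no `[cite:]` tag, no `Prop`-valued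
fact is minted (trigger `t4/T4-NE7b-TRIGGER.json` condition c1).

WHY.  The row's exit `CountThresholdUniform.relWeightBoundZ_of_irThreshold` — consumed through the socket
`HistorySocket.LiveHistories` ∕ `HistoryFlow.hybridNE7_of_liveHistories_tuned` — displays, besides the (ID)∕(P) socket,
the typed flow, the two `Regeneration` runs and the seam data, EIGHT model binders that are OURS to choose and prove:
cells `Cell K a` with `#Cell K a ≤ V·Λ^a`; an event table `E K j` with `hE` (steps in `(j, K]`) and a K-UNIFORM slice
budget `hηbar`; birth kinds `B K j` with a K-uniform budget `hρbar`; a matching scale `jstar` with `hj`, `hfrac`; and the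
two rates `Λ·e^{η̄−κ₁} < 1`, `Λ′·e^{ε}·e^{−κ₁} ≤ 1`.  Two of them constrain the leaves: (i) the cell type must be ONE
type for every cutoff (`cellOf : ℕ → Gen PEv → γ`), so the torus cells `ZoneTorus.cellsAt n L K s ⊆ TCell d (n·L^K)`
are read through `Fin.val` as ℕ-vectors; (ii) with the dictionary's full event universe `dictE Dcap` and a torus cap
`Dcap K ↑ ∞` the slice budget FAILS (renewal∕merger labels `(t,1,d)`, `(t,2,d)` weigh `e^{−E₀}` each, for every
`d < Dcap K`), so the table must carry THIN renewal∕merger labels `(t,1,0)`, `(t,2,0)` — the canonical menus of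
`T4CanonicalMenus` — next to the births `(t,0,d′)`, `d′ < Dcap K`; the genealogies of the leaves record renewals and
mergers with fat component `0` accordingly (the model tables `cost`∕`credit`∕`dictW` never read it).

WHAT (all [K]).  §1 `cellN d n L K a` (age-`a` cells as ℕ-vectors) with `card_cellN_le : #cellN ≤ n^d·(L^d)^a` for
EVERY age, and `valVec_mem_cellN` (a torus cell of scale `K − a` read through `Fin.val` is one).  §2 `evCanon Dcap K j`
(canonical event table), `mem_evCanon`, `evCanon_step` (= `hE`), `sum_evCanon_eta_le` (= `hηbar` with
`η̄ = birthMass C + 2e^{−E₀}`, needs `0 < C.μ`); `bkCanon Dcap K j` (birth kinds, EMPTY for `j > K` so that the budget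
does not ask the coupling beyond the cutoff), `mem_bkCanon`, `sum_bkCanon_rho_le` (= `hρbar` with `ρ̄ = birthMass C`,
needs `0 < C.μ` and `0 ≤ p₀(g_{K,j})` for `j ≤ K` only).  §3 the matching scale is the renewal member's
`T4RenewalChains.jhalf K = K ∕ 2` BY NAME: `jhalf_le` (= `hj`); `hfrac` with `c = ½` IS `T4RenewalChains.half_le_sub_jhalf`.  §4 the rates from ONE largeness condition on the bank rate: `rates_of_kappa_large`
(`d·log L + η̄ < κ₁` and `ε + d·log L ≤ κ₁` ⇒ `L^d·e^{η̄−κ₁} < 1 ∧ L^d·e^{ε}·e^{−κ₁} ≤ 1`).  §5 sanity (decided instances: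
a thin label is in the table, a fat merger label is not, no birth kinds beyond the cutoff, `jhalf 9 = 4`).

HONEST.  Model bookkeeping; discharges none of H3 ∕ (B) ∕ BetaPertH; NE7b NOT proved.  HONEST DEPENDENCY (cell):
continuum YM on T⁴ ⇐ BetaPertH ∧ nine spine estimates (0/9 proved); BetaPertH ⇐ (D1) ∧ (D4) ∧ CAP+tail.  This file
changes none of it.
-/

open Finset
open Literature.MathematicalPhysics.QuantumFieldTheory.Balaban1983to89
open T4PersistenceDictionary T4PrintedShapeBanking T4RecordPriceSeam T4CanonicalMenus
open Summit.QuantumFields.BalabanUV.T4Continuum.ZoneTorus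

namespace Summit.QuantumFields.BalabanUV.T4Continuum.HistoryTables

noncomputable section

/-! ## §1 Cells of every age as ℕ-vectors (one cell type for all cutoffs) -/

section Cells

variable {d : ℕ}

/-- **THE CELLS OF AGE `a` AT CUTOFF `K`** as ℕ-vectors: the scale-`(K − a)` cells of the torus with `n·L^K` sites a
side (`ZoneTorus.cellsAt`), read through `Fin.val`. [folklore] -/
def cellN (d n L K a : ℕ) : Finset (Fin d → ℕ) :=
  (cellsAt (d := d) n L K (K - a)).image fun x i => ((x i : Fin (n * L ^ K)) : ℕ)

/-- a torus cell of scale `K − a`, read through `Fin.val`, is a cell of age `a` [folklore] -/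
theorem valVec_mem_cellN {n L K a : ℕ} {x : TCell d (n * L ^ K)} (hx : IsScale L (K - a) x) :
    (fun i => ((x i : Fin (n * L ^ K)) : ℕ)) ∈ cellN d n L K a :=
  mem_image.2 ⟨x, by simpa [cellsAt] using hx, rfl⟩

/-- **THE CELL BINDER `hcell`**: `#cellN d n L K a ≤ n^d·(L^d)^a` for EVERY age `a` (for `a > K` the age-`a` cells
are the scale-`0` cells, `n^d·(L^d)^K ≤ n^d·(L^d)^a` of them). [folklore] -/
theorem card_cellN_le (d n : ℕ) {L : ℕ} (hL : 1 ≤ L) (K a : ℕ) :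
    ((cellN d n L K a).card : ℝ) ≤ (n : ℝ) ^ d * ((L : ℝ) ^ d) ^ a := by
  have h1 : ((cellN d n L K a).card : ℝ) ≤ ((cellsAt (d := d) n L K (K - a)).card : ℝ) := by
    exact_mod_cast card_image_le
  rw [card_cellsAt_real n hL (Nat.sub_le K a)] at h1
  refine h1.trans (mul_le_mul_of_nonneg_left ?_ (by positivity))
  have hΛ : (1 : ℝ) ≤ (L : ℝ) ^ d := one_le_pow₀ (by exact_mod_cast hL)
  exact pow_le_pow_right₀ hΛ (by omega)

end Cells

/-! ## §2 The canonical event table and birth kinds, with their K-uniform budgets -/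

section Tables

/-- **THE CANONICAL EVENT TABLE** of a slot born at `j`, cutoff `K`: births `(t, 0, d′)` of class `d′ < Dcap K` and
THIN renewal ∕ merger labels `(t, 1, 0)`, `(t, 2, 0)`, at steps `t ∈ (j, K]`. [folklore] -/
def evCanon (Dcap : ℕ → ℕ) (K j : ℕ) : Finset PEv :=
  (Ioc j K) ×ˢ (((({0} : Finset (Fin 3)) ×ˢ range (Dcap K)) ∪ (({1, 2} : Finset (Fin 3)) ×ˢ ({0} : Finset ℕ))))

/-- membership in the canonical event table [folklore] -/
theorem mem_evCanon {Dcap : ℕ → ℕ} {K j : ℕ} {e : PEv} :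
    e ∈ evCanon Dcap K j ↔
      e.step ∈ Ioc j K ∧ (e.kind = 0 ∧ e.fat < Dcap K ∨ (e.kind = 1 ∨ e.kind = 2) ∧ e.fat = 0) := by
  obtain ⟨s, k, f⟩ := e
  simp only [evCanon, mem_product, mem_union, mem_insert, mem_singleton, mem_range, PEv.step, PEv.kind, PEv.fat]

/-- a birth label of class `< Dcap K` at a step in `(j, K]` is in the table [folklore] -/
theorem birth_mem_evCanon {Dcap : ℕ → ℕ} {K j t f : ℕ} (ht : t ∈ Ioc j K) (hf : f < Dcap K) :
    ((t, 0, f) : PEv) ∈ evCanon Dcap K j :=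
  mem_evCanon.2 ⟨ht, Or.inl ⟨rfl, hf⟩⟩

/-- the thin renewal label at a step in `(j, K]` is in the table [folklore] -/
theorem renewal_mem_evCanon {Dcap : ℕ → ℕ} {K j t : ℕ} (ht : t ∈ Ioc j K) :
    ((t, 1, 0) : PEv) ∈ evCanon Dcap K j :=
  mem_evCanon.2 ⟨ht, Or.inr ⟨Or.inl rfl, rfl⟩⟩

/-- the thin merger label at a step in `(j, K]` is in the table [folklore] -/
theorem merger_mem_evCanon {Dcap : ℕ → ℕ} {K j t : ℕ} (ht : t ∈ Ioc j K) :
    ((t, 2, 0) : PEv) ∈ evCanon Dcap K j :=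
  mem_evCanon.2 ⟨ht, Or.inr ⟨Or.inr rfl, rfl⟩⟩

/-- **THE BINDER `hE`**: table events sit at steps in `(j, K]`. [folklore] -/
theorem evCanon_step (Dcap : ℕ → ℕ) (K j : ℕ) : ∀ e ∈ evCanon Dcap K j, PEv.step e ∈ Ioc j K :=
  fun _ he => (mem_evCanon.1 he).1

/-- the step-`t` slice of the table lies in the birth kinds at `t` plus the two thin labels [folklore] -/
theorem evCanon_slice_subset (Dcap : ℕ → ℕ) (K j t : ℕ) :
    (evCanon Dcap K j).filter (fun e => PEv.step e = t) ⊆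
      dictB Dcap K t ∪ ({((t, 1, 0) : PEv)} ∪ {((t, 2, 0) : PEv)}) := by
  intro e he
  rw [mem_filter] at he
  obtain ⟨he, hst⟩ := he
  obtain ⟨-, hk⟩ := mem_evCanon.1 he
  obtain ⟨s, k, f⟩ := e
  simp only [PEv.step_mk] at hst
  subst hst
  simp only [PEv.kind_mk, PEv.fat_mk] at hk
  rcases hk with ⟨rfl, hf⟩ | ⟨rfl | rfl, rfl⟩
  · exact mem_union_left _ (mem_dictB.2 ⟨rfl, rfl, hf⟩)
  · exact mem_union_right _ (mem_union_left _ (mem_singleton_self _))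
  · exact mem_union_right _ (mem_union_right _ (mem_singleton_self _))

/-- **THE BINDER `hηbar`**: every step-`t` slice of the canonical table weighs at most `birthMass C + 2·e^{−E₀}` in the
count's currency `eta` — UNIFORMLY in the cutoff and the cap (births: the geometric class series
`T4CanonicalMenus.sum_dictB_eta_le`, `0 < μ`; the two thin labels: `e^{−E₀}` each). [folklore] -/
theorem sum_evCanon_eta_le {C : T4PrintedShapeBanking.Consts} (hμ : 0 < C.μ) (Dcap : ℕ → ℕ) (K j : ℕ) :
    ∀ t ∈ Ioc j K, ∑ e ∈ evCanon Dcap K j with PEv.step e = t, eta C e ≤ birthMass C + 2 * Real.exp (-C.E₀) := by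
  intro t _
  have h0 : ∀ e ∈ dictB Dcap K t ∪ ({((t, 1, 0) : PEv)} ∪ {((t, 2, 0) : PEv)}), 0 ≤ eta C e :=
    fun e _ => (eta_pos C e).le
  refine (sum_le_sum_of_subset_of_nonneg (evCanon_slice_subset Dcap K j t) fun e he _ => h0 e he).trans ?_
  have hdisj₁ : Disjoint (dictB Dcap K t) ({((t, 1, 0) : PEv)} ∪ {((t, 2, 0) : PEv)}) := by
    rw [disjoint_left]
    intro e he he'
    have hk := (mem_dictB.1 he).2.1
    simp only [mem_union, mem_singleton] at he'
    rcases he' with rfl | rfl <;> simp [PEv.kind] at hk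
  have hdisj₂ : Disjoint ({((t, 1, 0) : PEv)} : Finset PEv) {((t, 2, 0) : PEv)} := by
    rw [disjoint_singleton_left, mem_singleton]; simp
  rw [sum_union hdisj₁, sum_union hdisj₂, sum_singleton, sum_singleton]
  have h1 : eta C ((t, 1, 0) : PEv) = Real.exp (-C.E₀) := by
    rw [eta_eq, Emarg_kind1 (by rfl)]
  have h2 : eta C ((t, 2, 0) : PEv) = Real.exp (-C.E₀) := by
    rw [eta_eq, Emarg_kind2 (by rfl)]
  rw [h1, h2]
  linarith [sum_dictB_eta_le hμ Dcap K t]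

/-- **THE BIRTH KINDS** of a slot born at `j`, cutoff `K`: the dictionary's `dictB Dcap K j` for `j ≤ K`, EMPTY beyond
the cutoff (no structure is born after the cutoff; the budget then asks nothing of the run's couplings `g_{K,j}`,
`j > K`, which the typed flow does not control). [folklore] -/
def bkCanon (Dcap : ℕ → ℕ) (K j : ℕ) : Finset PEv := if j ≤ K then dictB Dcap K j else ∅

/-- membership in the birth kinds [folklore] -/
theorem mem_bkCanon {Dcap : ℕ → ℕ} {K j : ℕ} {e : PEv} :
    e ∈ bkCanon Dcap K j ↔ j ≤ K ∧ e.step = j ∧ e.kind = 0 ∧ e.fat < Dcap K := by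
  unfold bkCanon
  split_ifs with h
  · rw [mem_dictB]; exact ⟨fun h' => ⟨h, h'⟩, fun h' => h'.2⟩
  · simp [h]

/-- a birth label `(j, 0, f)`, `f < Dcap K`, `j ≤ K`, is a birth kind of its slot [folklore] -/
theorem birth_mem_bkCanon {Dcap : ℕ → ℕ} {K j f : ℕ} (hj : j ≤ K) (hf : f < Dcap K) :
    ((j, 0, f) : PEv) ∈ bkCanon Dcap K j :=
  mem_bkCanon.2 ⟨hj, rfl, rfl, hf⟩

/-- **THE BINDER `hρbar`**: the birth kinds of every slot weigh at most `birthMass C` in the currency `rho C (g K)`,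
uniformly — given `0 < μ` and a nonnegative profile `0 ≤ p₀(g_{K,j})` AT THE STEPS `j ≤ K` ONLY (met along the typed
flow by `1 ≤ log g_{K,j}⁻²`, `T4CanonicalMenus.p0Profile_nonneg_of_one_le_log`). [folklore] -/
theorem sum_bkCanon_rho_le {C : T4PrintedShapeBanking.Consts} (hμ : 0 < C.μ) (Dcap : ℕ → ℕ) {g : ℕ → ℕ → ℝ}
    (hP : ∀ K j, j ≤ K → 0 ≤ p0Profile C.A₀ C.p₀ (g K j)) (K j : ℕ) :
    ∑ b ∈ bkCanon Dcap K j, rho C (g K) b ≤ birthMass C := by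
  unfold bkCanon
  split_ifs with h
  · exact sum_dictB_rho_le hμ Dcap K j (hP K j h)
  · rw [sum_empty]; exact birthMass_nonneg hμ

/-- … the profile hypothesis from the typed-flow binder `hx1` (`1 ≤ log g_{K,s}⁻²` for `s ≤ K`) and `A₀ ≥ 0`.
[folklore] -/
theorem sum_bkCanon_rho_le_of_hx1 {C : T4PrintedShapeBanking.Consts} (hμ : 0 < C.μ) (hA : 0 ≤ C.A₀)
    (Dcap : ℕ → ℕ) {g : ℕ → ℕ → ℝ} (hx1 : ∀ K s, s ≤ K → 1 ≤ Real.log ((g K s) ^ 2)⁻¹) (K j : ℕ) :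
    ∑ b ∈ bkCanon Dcap K j, rho C (g K) b ≤ birthMass C :=
  sum_bkCanon_rho_le hμ Dcap (fun K j hj => p0Profile_nonneg_of_one_le_log C.p₀ hA (hx1 K j hj)) K j

end Tables

/-! ## §3 The matching scale: the renewal member's `jhalf` by name -/

section Matching

open T4RenewalChains

/-- **THE BINDER `hj`** for the matching scale `j⋆(K) = T4RenewalChains.jhalf K = K ∕ 2` (a live structure born before
it is OLD): `j⋆(K) ≤ K`.  The binder `hfrac` with `c = ½` is `T4RenewalChains.half_le_sub_jhalf`, by name. [folklore] -/
theorem jhalf_le (K : ℕ) : jhalf K ≤ K := Nat.div_le_self K 2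

end Matching

/-! ## §4 The two rates from one largeness condition on the bank rate -/

section Rates

/-- `L^d = e^{d·log L}` for `L ≥ 1`. [folklore] -/
theorem pow_eq_exp_mul_log {L : ℕ} (hL : 1 ≤ L) (d : ℕ) :
    ((L : ℝ) ^ d : ℝ) = Real.exp (d * Real.log L) := by
  have hLpos : (0 : ℝ) < L := by exact_mod_cast hL
  rw [← Real.log_pow, Real.exp_log (pow_pos hLpos d)]

/-- **THE RATE BINDERS `hrate` ∕ `hΛ1` FROM ONE LARGENESS CONDITION ON `κ₁`** (`Λ = Λ′ = L^d`): if
`d·log L + η̄ < κ₁` and `ε + d·log L ≤ κ₁` then `L^d·e^{η̄−κ₁} < 1` and `L^d·e^{ε}·e^{−κ₁} ≤ 1`.  (Larger `κ₁` only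
raises the infrared threshold `irThresholdZ`; the credits pay it.) [folklore] -/
theorem rates_of_kappa_large {L : ℕ} (hL : 1 ≤ L) (d : ℕ) {ηbar ε κ₁ : ℝ} (h1 : d * Real.log L + ηbar < κ₁)
    (h2 : ε + d * Real.log L ≤ κ₁) :
    (L : ℝ) ^ d * Real.exp (ηbar - κ₁) < 1 ∧ (L : ℝ) ^ d * Real.exp ε * Real.exp (-κ₁) ≤ 1 := by
  rw [pow_eq_exp_mul_log hL d]
  constructor
  · rw [← Real.exp_add, Real.exp_lt_one_iff]; linarith
  · rw [← Real.exp_add, ← Real.exp_add, Real.exp_le_one_iff]; linarith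

end Rates

/-! ## §5 Sanity (decided ∕ by `simp`) -/

namespace Sanity

/-- the thin merger label at step `3` is in the table of a slot born at `1`, cutoff `5`, cap `7` -/
example : ((3, 2, 0) : PEv) ∈ evCanon (fun _ => 7) 5 1 := merger_mem_evCanon (by simp)

/-- a FAT merger label is NOT in the table (the point of the thin menus) -/
example : ((3, 2, 4) : PEv) ∉ evCanon (fun _ => 7) 5 1 := by simp [mem_evCanon, PEv.kind, PEv.fat, PEv.step]

/-- no birth kinds beyond the cutoff -/
example : bkCanon (fun _ => 7) 5 6 = ∅ := by simp [bkCanon]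

/-- the matching scale of cutoff `9` is `4`, and `hfrac` there reads `9∕2 ≤ 9 − 4` -/
example : T4RenewalChains.jhalf 9 = 4 := rfl
example : (1 / 2 : ℝ) * (9 : ℕ) ≤ ((9 - T4RenewalChains.jhalf 9 : ℕ) : ℝ) := T4RenewalChains.half_le_sub_jhalf 9

end Sanity

end

end Summit.QuantumFields.BalabanUV.T4Continuum.HistoryTables
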